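import Literature.InformationTheory.QuantumCodes.ToricCodeThreshold
import Literature.Probability.RandomPlanarGeometry.SAWWordsZd
import HarnessLib

/-!
# Self-avoiding polygons on the toric lattice: links, the cycle they carry, and their number
# (`n_SAP(H) ≤ L² · c_{H-1}`)

Topic `Literature/InformationTheory/QuantumCodes` (venture QEC, LADDER-QEC rung Q5). Second
theorem file towards the discharge of the Dennis–Kitaev–Landahl–Preskill counting bound
`ToricCode.failureProb_le_of_sawCountBound` (`ToricCodeThreshold.lean`, qec-type-09).

A closed lattice path on the `L × L` torus is coded, as in the tree's self-avoiding-walk files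
(`Literature.Probability.RandomPlanarGeometry.SAW.Zd.Word`: step words `w : List (Fin 2 × Bool)`,
trajectory `Word.traj w i ∈ ℤ²`), by a start site `v` and a step word `w`; its sites are
`tpos v w i = v + (Word.traj w i mod L)` and the link traversed at step `k` is `edgeAt v w k`.

* `toSym2 ℓ = s(u, u + eᵢ)` — the two end sites of the link `ℓ = (u, i)`; for `L ≥ 3` a link is
  determined by its end sites (`toSym2_injective`);
* `IsPolygon v w` — **self-avoiding polygon** ("self-avoiding polygon of length `H`", DKLP §5.2):
  `|w| ≥ 3`, the path closes up (`tpos v w |w| = v`) and its sites `tpos v w 0, …, tpos v w (|w|-1)`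
  are distinct; then its links are distinct (`IsPolygon.edgeAt_injOn`), so the polygon has
  exactly `H = |w|` links (`IsPolygon.card_polygonEdges`);
* `polygonChain v w = Σ_k 𝟙_{edgeAt v w k}` — the `ℤ₂`-chain of the polygon; it is a CYCLE
  (`polygonChain_mem_cycles`: the boundary of a link is the sum of its two end sites, and the sum
  telescopes around the closed path), it is the indicator of the link set and has weight `H`;
* **`card_polygons_le`** — the number of link sets of self-avoiding polygons with `H` links is at
  most `L² · c_{H-1}` (`c_n = #Word.sawWords 2 n = SAW.count n`): a polygon is recovered from its
  start site and its first `H - 1` steps, which form a self-avoiding walk of `ℤ²` (the lift of a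
  self-avoiding lattice path is self-avoiding), the last link being the unique link joining the
  last site back to the start ("`n_SAP(H)`, the number of self-avoiding polygons … is bounded by the
  number of self-avoiding walks", DKLP §5.2–5.3).

## References

* [DennisEtAl2002] E. Dennis, A. Kitaev, A. Landahl, J. Preskill, *Topological quantum memory*,
  J. Math. Phys. 43 (2002) 4452–4505, arXiv:quant-ph/0110143, §5.2 (self-avoiding polygons on the
  toric lattice, eq. (28)), §5.3 (counting them by self-avoiding walks, eq. (29)).
* [MadrasSlade1993] N. Madras, G. Slade, *The Self-Avoiding Walk*, Birkhäuser 1993, §1.1 (step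
  words and trajectories; the tree's `SAW.Zd.Word`).
-/

namespace Literature.InformationTheory.QuantumCodes

namespace ToricCode

open Finset Matrix
open Literature.Probability.LatticeModels (TorusSite Site Torus.proj)
open Literature.Probability.Percolation (stepVec)
open Literature.Probability.RandomPlanarGeometry.SAW.Zd

variable {L : ℕ}

/-! ### Links and their end sites -/

/-- The two end sites `{u, u + eᵢ}` of the link `ℓ = (u, i)`, as an unordered pair.
[cite: DennisEtAl2002, §3.1 (links of the square lattice on the torus)] -/
def toSym2 (ℓ : Edge L) : Sym2 (Vertex L) := s(ℓ.1, ℓ.1 + dir ℓ.2)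

/-- The unit vectors are non-zero for `L ≥ 2`. [folklore] -/
private theorem dir_ne_zero (hL : 2 ≤ L) (i : Fin 2) : (dir i : Vertex L) ≠ 0 := by
  intro h
  have h1 := congrFun h i
  simp only [dir, Pi.single_eq_same, Pi.zero_apply] at h1
  haveI : Fact (1 < L) := ⟨hL⟩
  exact one_ne_zero h1

/-- The two unit vectors are distinct for `L ≥ 2`. [folklore] -/
private theorem dir_injective (hL : 2 ≤ L) : Function.Injective (dir : Fin 2 → Vertex L) := by
  intro i j h
  by_contra hij
  have h1 := congrFun h i
  simp only [dir, Pi.single_eq_same, Pi.single_apply, if_neg hij] at h1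
  haveI : Fact (1 < L) := ⟨hL⟩
  exact one_ne_zero h1

/-- For `L ≥ 3` no two unit vectors (equal or not) sum to zero. [folklore] -/
private theorem dir_add_dir_ne_zero (hL : 3 ≤ L) (i j : Fin 2) : (dir i : Vertex L) + dir j ≠ 0 := by
  intro h
  have hi := congrFun h i
  simp only [dir, Pi.add_apply, Pi.single_eq_same, Pi.single_apply, Pi.zero_apply] at hi
  split_ifs at hi with hji
  · -- 1 + 1 = 0 in ZMod L forces L ∣ 2
    have h2 : ((2 : ℕ) : ZMod L) = 0 := by
      rw [show ((2 : ℕ) : ZMod L) = 1 + 1 by norm_num]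
      exact hi
    rw [ZMod.natCast_eq_zero_iff] at h2
    have := Nat.le_of_dvd (by norm_num) h2
    omega
  · rw [add_zero] at hi
    haveI : Fact (1 < L) := ⟨by omega⟩
    exact one_ne_zero hi

/-- **A link is determined by its two end sites** (`L ≥ 3`; for `L ≤ 2` the lattice has
multiple links between the same sites). [cite: DennisEtAl2002, §3.1 (links of the L × L lattice)] -/
theorem toSym2_injective (hL : 3 ≤ L) : Function.Injective (toSym2 : Edge L → Sym2 (Vertex L)) := by
  rintro ⟨u, i⟩ ⟨u', i'⟩ h
  simp only [toSym2, Sym2.eq_iff] at h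
  rcases h with ⟨rfl, h2⟩ | ⟨h1, h2⟩
  · have : i = i' := dir_injective (by omega) (add_left_cancel h2)
    rw [this]
  · exfalso
    rw [h1, add_assoc] at h2
    exact dir_add_dir_ne_zero hL i' i (add_eq_left.1 h2)

/-! ### Lattice paths on the torus coded by step words -/

/-- Reduction `ℤ² → ℤ_L²` is additive. [folklore] -/
private theorem proj_add (x y : Site 2) : (Torus.proj L (x + y) : Vertex L) = Torus.proj L x + Torus.proj L y := by
  ext i; simp [Torus.proj]

/-- Reduction of the origin. [folklore] -/
private theorem proj_zero : (Torus.proj L (0 : Site 2) : Vertex L) = 0 := by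
  ext i; simp [Torus.proj]

/-- The reduction of a unit step `± eᵢ` of `ℤ²` is `± eᵢ` on the torus. [folklore] -/
private theorem proj_stepVec (a : Fin 2 × Bool) :
    (Torus.proj L (stepVec a) : Vertex L) = if a.2 then dir a.1 else -dir a.1 := by
  obtain ⟨i, b⟩ := a
  ext j
  cases b <;> simp [Torus.proj, stepVec, dir, Pi.single_apply]

/-- The site reached after `i` steps of the word `w` from `v` (frozen at the end for `i ≥ |w|`):
the reduction mod `L` of the `ℤ²`-trajectory `Word.traj w i`, translated to start at `v`.
[cite: DennisEtAl2002, §5.2 (lattice paths on the torus)] -/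
def tpos (v : Vertex L) (w : List (Fin 2 × Bool)) (i : ℕ) : Vertex L := v + Torus.proj L (Word.traj w i)

/-- The path starts at `v`. [cite: DennisEtAl2002, §5.2 (lattice paths on the torus)] -/
@[simp] theorem tpos_zero (v : Vertex L) (w : List (Fin 2 × Bool)) : tpos v w 0 = v := by
  simp [tpos, proj_zero]

/-- One step: `tpos v w (i+1) = tpos v w i ± e`. [cite: DennisEtAl2002, §5.2 (lattice paths on the torus)] -/
theorem tpos_succ (v : Vertex L) (w : List (Fin 2 × Bool)) {i : ℕ} (hi : i < w.length) :
    tpos v w (i + 1) = tpos v w i + Torus.proj L (stepVec (w[i])) := by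
  simp only [tpos, Word.traj_succ w hi, proj_add, add_assoc]

/-- The path of a prefix agrees with the original up to its length. [cite: MadrasSlade1993, §1.1] -/
theorem tpos_take (v : Vertex L) (w : List (Fin 2 × Bool)) {i k : ℕ} (hik : i ≤ k) :
    tpos v (w.take k) i = tpos v w i := by
  simp only [tpos, Word.traj_take w hik]

/-- The path of `w ++ w'` up to time `|w|` is that of `w`. [cite: MadrasSlade1993, §1.1] -/
theorem tpos_append_left (v : Vertex L) (w w' : List (Fin 2 × Bool)) {i : ℕ} (hi : i ≤ w.length) :
    tpos v (w ++ w') i = tpos v w i := by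
  simp only [tpos, Word.traj_append_left w w' hi]

/-- The path of `w ++ w'` after time `|w|` is the path of `w'` from the end of `w`. [cite: MadrasSlade1993, §1.1] -/
theorem tpos_append_right (v : Vertex L) (w w' : List (Fin 2 × Bool)) (i : ℕ) :
    tpos v (w ++ w') (w.length + i) = tpos (tpos v w w.length) w' i := by
  simp only [tpos, Word.traj_append_right, proj_add, Word.traj_length, add_assoc]

/-- The path of the suffix `w.drop i` from the site `tpos v w i` is the rest of the path of `w`.
[cite: MadrasSlade1993, §1.1] -/
theorem tpos_drop (v : Vertex L) (w : List (Fin 2 × Bool)) {i : ℕ} (hi : i ≤ w.length) (k : ℕ) :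
    tpos (tpos v w i) (w.drop i) k = tpos v w (i + k) := by
  have hlen : (w.take i).length = i := by simp [min_eq_left hi]
  have h := tpos_append_right v (w.take i) (w.drop i) k
  rw [List.take_append_drop, hlen, tpos_take v w le_rfl] at h
  exact h.symm

/-- The link traversed by the step `a = (i, ±)` from the site `x`: `(x, i)` for `+eᵢ` and
`(x - eᵢ, i)` for `-eᵢ`. [cite: DennisEtAl2002, §5.2 (links of a lattice path)] -/
def stepEdge (x : Vertex L) (a : Fin 2 × Bool) : Edge L := if a.2 then (x, a.1) else (x - dir a.1, a.1)

/-- The end sites of the link of a step are the sites before and after the step.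
[cite: DennisEtAl2002, §5.2 (links of a lattice path)] -/
theorem toSym2_stepEdge (x : Vertex L) (a : Fin 2 × Bool) :
    toSym2 (stepEdge x a) = s(x, x + Torus.proj L (stepVec a)) := by
  rw [proj_stepVec]
  unfold stepEdge toSym2
  obtain ⟨i, b⟩ := a
  cases b
  · simp only [Bool.false_eq_true, if_false, sub_add_cancel]
    rw [Sym2.eq_swap, ← sub_eq_add_neg]
  · simp

/-- The link traversed at step `k` of the word `w` from `v` (junk for `k ≥ |w|`).
[cite: DennisEtAl2002, §5.2 (links of a lattice path)] -/
def edgeAt (v : Vertex L) (w : List (Fin 2 × Bool)) (k : ℕ) : Edge L :=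
  stepEdge (tpos v w k) (w.getD k (0, true))

/-- The link of step `k` joins the sites `k` and `k+1` of the path. [cite: DennisEtAl2002, §5.2 (links of a lattice path)] -/
theorem toSym2_edgeAt (v : Vertex L) (w : List (Fin 2 × Bool)) {k : ℕ} (hk : k < w.length) :
    toSym2 (edgeAt v w k) = s(tpos v w k, tpos v w (k + 1)) := by
  rw [edgeAt, toSym2_stepEdge, tpos_succ v w hk, List.getD_eq_getElem?_getD,
    List.getElem?_eq_getElem hk, Option.getD_some]

/-- The links of a prefix are those of the word. [cite: MadrasSlade1993, §1.1] -/
theorem edgeAt_take (v : Vertex L) (w : List (Fin 2 × Bool)) {k n : ℕ} (hk : k < n) :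
    edgeAt v (w.take n) k = edgeAt v w k := by
  unfold edgeAt
  rw [tpos_take v w hk.le, List.getD_eq_getElem?_getD, List.getD_eq_getElem?_getD,
    List.getElem?_take_of_lt hk]

/-- The links of `w ++ w'` before time `|w|` are those of `w`. [cite: MadrasSlade1993, §1.1] -/
theorem edgeAt_append_left (v : Vertex L) (w w' : List (Fin 2 × Bool)) {k : ℕ} (hk : k < w.length) :
    edgeAt v (w ++ w') k = edgeAt v w k := by
  unfold edgeAt
  rw [tpos_append_left v w w' hk.le, List.getD_eq_getElem?_getD, List.getD_eq_getElem?_getD,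
    List.getElem?_append_left hk]

/-- The link of `w ++ [a]` at time `|w|` is the link of the step `a` from the end of `w`.
[cite: MadrasSlade1993, §1.1] -/
theorem edgeAt_append_single (v : Vertex L) (w : List (Fin 2 × Bool)) (a : Fin 2 × Bool) :
    edgeAt v (w ++ [a]) w.length = stepEdge (tpos v w w.length) a := by
  unfold edgeAt
  rw [tpos_append_left v w [a] le_rfl, List.getD_eq_getElem?_getD,
    List.getElem?_append_right le_rfl]
  simp

/-- The links of the suffix `w.drop i` from `tpos v w i` are the later links of `w`.
[cite: MadrasSlade1993, §1.1] -/
theorem edgeAt_drop (v : Vertex L) (w : List (Fin 2 × Bool)) {i : ℕ} (hi : i ≤ w.length) (k : ℕ) :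
    edgeAt (tpos v w i) (w.drop i) k = edgeAt v w (i + k) := by
  unfold edgeAt
  rw [tpos_drop v w hi k, List.getD_eq_getElem?_getD, List.getD_eq_getElem?_getD, List.getElem?_drop]

/-- The link set of the path `w` from `v`. [cite: DennisEtAl2002, §5.2 (links of a lattice path)] -/
def polygonEdges (v : Vertex L) (w : List (Fin 2 × Bool)) : Finset (Edge L) :=
  (range w.length).image (edgeAt v w)

/-- The `ℤ₂`-chain of the path: the sum of the indicators of its links (a link traversed twice
cancels). [cite: DennisEtAl2002, §4.4 (chains as ℤ₂-valued functions on links)] -/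
def polygonChain (v : Vertex L) (w : List (Fin 2 × Bool)) : Chain L :=
  ∑ k ∈ range w.length, Pi.single (edgeAt v w k) 1

/-! ### Self-avoiding polygons -/

/-- **Self-avoiding polygon** on the toric lattice, coded by a start site `v` and a step word `w`
of length `H = |w| ≥ 3`: the path closes up after `H` steps and its first `H` sites are pairwise
distinct. [cite: DennisEtAl2002, §5.2 ("self-avoiding polygon of length H")] -/
structure IsPolygon (v : Vertex L) (w : List (Fin 2 × Bool)) : Prop where
  /-- a polygon has at least three links -/
  three_le : 3 ≤ w.length
  /-- the path returns to its start -/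
  closed : tpos v w w.length = v
  /-- the sites `0, …, H-1` are distinct -/
  nodup : ∀ i j, i < w.length → j < w.length → tpos v w i = tpos v w j → i = j

namespace IsPolygon

variable {v : Vertex L} {w : List (Fin 2 × Bool)}

/-- Site distinctness including the closing time `H` (which carries the site `v` of time `0`):
for `i, j ≤ H` with equal sites, `i = j` or `{i, j} = {0, H}`. [cite: DennisEtAl2002, §5.2 (self-avoiding polygon)] -/
theorem eq_or_of_tpos_eq (hP : IsPolygon v w) {i j : ℕ} (hi : i ≤ w.length) (hj : j ≤ w.length)
    (h : tpos v w i = tpos v w j) : i = j ∨ (i = 0 ∧ j = w.length) ∨ (i = w.length ∧ j = 0) := by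
  have key : ∀ i, i ≤ w.length → tpos v w i = tpos v w (if i = w.length then 0 else i) := by
    intro i hi
    split_ifs with h
    · rw [h, hP.closed, tpos_zero]
    · rfl
  have hlt : ∀ i, i ≤ w.length → (if i = w.length then 0 else i) < w.length := by
    intro i hi
    split_ifs with h
    · exact lt_of_lt_of_le (by norm_num) hP.three_le
    · exact lt_of_le_of_ne hi h
  rw [key i hi, key j hj] at h
  have := hP.nodup _ _ (hlt i hi) (hlt j hj) h
  split_ifs at this with h1 h2 h2 <;> omega

/-- **The links of a self-avoiding polygon are distinct.** [cite: DennisEtAl2002, §5.2 (self-avoiding polygon of length H)] -/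
theorem edgeAt_injOn (hP : IsPolygon v w) : Set.InjOn (edgeAt v w) (Set.Iio w.length) := by
  intro a ha b hb hab
  simp only [Set.mem_Iio] at ha hb
  have h := congrArg toSym2 hab
  rw [toSym2_edgeAt v w ha, toSym2_edgeAt v w hb, Sym2.eq_iff] at h
  have h3 := hP.three_le
  rcases h with ⟨h1, -⟩ | ⟨h1, h2⟩
  · rcases hP.eq_or_of_tpos_eq ha.le hb.le h1 with h | h | h <;> omega
  · rcases hP.eq_or_of_tpos_eq ha.le (Nat.succ_le_of_lt hb) h1 with h | h | h <;>
      rcases hP.eq_or_of_tpos_eq (Nat.succ_le_of_lt ha) hb.le h2 with h' | h' | h' <;> omega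

/-- A self-avoiding polygon of length `H` has exactly `H` links. [cite: DennisEtAl2002, §5.2 (self-avoiding polygon of length H)] -/
theorem card_polygonEdges (hP : IsPolygon v w) : (polygonEdges v w).card = w.length := by
  rw [polygonEdges, Finset.card_image_of_injOn (by simpa using hP.edgeAt_injOn), Finset.card_range]

end IsPolygon

/-! ### The chain of a polygon is a cycle -/

/-- The star syndrome at a site is the sum of the four incident link values (as in
`ToricCodeCycles.lean`). [cite: DennisEtAl2002, §3.1 (X_s = ⊗_{ℓ ∋ s} X_ℓ)] -/
private theorem starMatrix_mulVec_apply' [NeZero L] (z : Chain L) (s : Vertex L) :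
    (starMatrix L *ᵥ z) s = z (s, 0) + z (s, 1) + z (s - dir 0, 0) + z (s - dir 1, 1) := by
  change starRow s ⬝ᵥ z = _
  simp only [starRow, add_dotProduct, single_dotProduct, one_mul]

/-- **The boundary of a single link is the sum of its two end sites**:
`H^X 𝟙_ℓ = 𝟙_u + 𝟙_{u + eᵢ}` for `ℓ = (u, i)`. [cite: DennisEtAl2002, §4.3 (the boundary of an error chain)] -/
theorem starMatrix_mulVec_single [NeZero L] (ℓ : Edge L) (x : Vertex L) :
    (starMatrix L *ᵥ Pi.single ℓ (1 : ZMod 2)) x =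
      (Pi.single ℓ.1 (1 : ZMod 2) : Vertex L → ZMod 2) x +
        (Pi.single (ℓ.1 + dir ℓ.2) (1 : ZMod 2) : Vertex L → ZMod 2) x := by
  obtain ⟨u, i⟩ := ℓ
  rw [starMatrix_mulVec_apply']
  simp only [Pi.single_apply, Prod.mk.injEq, sub_eq_iff_eq_add]
  fin_cases i
  · simp only [Fin.zero_eta, Fin.isValue, and_true, one_ne_zero, and_false, if_false, add_zero]
    rcases eq_or_ne x u with h | h <;> rcases eq_or_ne x (u + dir 0) with h' | h' <;>
      simp only [h, h', if_true, if_false]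
  · simp only [Fin.mk_one, Fin.isValue, and_true, zero_ne_one, and_false, if_false, add_zero,
      zero_add]
    rcases eq_or_ne x u with h | h <;> rcases eq_or_ne x (u + dir 1) with h' | h' <;>
      simp only [h, h', if_true, if_false]

/-- The boundary of the link of a step: the sites before and after the step.
[cite: DennisEtAl2002, §4.3 (the boundary of an error chain)] -/
theorem starMatrix_mulVec_single_edgeAt [NeZero L] (v : Vertex L) (w : List (Fin 2 × Bool)) {k : ℕ}
    (hk : k < w.length) (x : Vertex L) :
    (starMatrix L *ᵥ Pi.single (edgeAt v w k) (1 : ZMod 2)) x =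
      (Pi.single (tpos v w k) (1 : ZMod 2) : Vertex L → ZMod 2) x +
        (Pi.single (tpos v w (k + 1)) (1 : ZMod 2) : Vertex L → ZMod 2) x := by
  rw [starMatrix_mulVec_single]
  -- the end sites of `edgeAt v w k` are `tpos k` and `tpos (k+1)` (as an unordered pair)
  have h := toSym2_edgeAt v w hk
  simp only [toSym2, Sym2.eq_iff] at h
  rcases h with ⟨h1, h2⟩ | ⟨h1, h2⟩
  · rw [h2, h1]
  · rw [h2, h1, add_comm]

/-- `x + x = 0` in `ℤ₂`. [folklore] -/
private theorem zmod2_add_self (x : ZMod 2) : x + x = 0 := by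
  revert x; decide

/-- Telescoping around a path, in `ℤ₂`: `Σ_{k<m} (f k + f (k+1)) = f 0 + f m`. [folklore] -/
private theorem zmod2_telescope (f : ℕ → ZMod 2) (m : ℕ) :
    ∑ k ∈ range m, (f k + f (k + 1)) = f 0 + f m := by
  induction m with
  | zero => simp [zmod2_add_self]
  | succ m ih =>
    rw [Finset.sum_range_succ, ih]
    have := zmod2_add_self (f m)
    calc f 0 + f m + (f m + f (m + 1)) = f 0 + f (m + 1) + (f m + f m) := by ring
      _ = f 0 + f (m + 1) := by rw [this, add_zero]

/-- **The chain of a closed path is a cycle**: its boundary telescopes to `𝟙_v + 𝟙_v = 0`.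
[cite: DennisEtAl2002, §4.3 (a closed chain has no boundary)] -/
theorem polygonChain_mem_cycles [NeZero L] {v : Vertex L} {w : List (Fin 2 × Bool)}
    (hclosed : tpos v w w.length = v) : polygonChain v w ∈ cycles L := by
  change syn L (polygonChain v w) = 0
  unfold syn polygonChain
  funext x
  rw [Matrix.mulVec_sum, Finset.sum_apply, Pi.zero_apply]
  have hterm : ∀ k ∈ range w.length, (starMatrix L *ᵥ Pi.single (edgeAt v w k) (1 : ZMod 2)) x =
      (Pi.single (tpos v w k) (1 : ZMod 2) : Vertex L → ZMod 2) x +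
        (Pi.single (tpos v w (k + 1)) (1 : ZMod 2) : Vertex L → ZMod 2) x :=
    fun k hk => starMatrix_mulVec_single_edgeAt v w (Finset.mem_range.1 hk) x
  rw [Finset.sum_congr rfl hterm,
    zmod2_telescope (fun k => (Pi.single (tpos v w k) (1 : ZMod 2) : Vertex L → ZMod 2) x),
    hclosed, tpos_zero, zmod2_add_self]

/-- The chain of a polygon is the indicator of its link set (the links being distinct).
[cite: DennisEtAl2002, §4.4 (n_E(ℓ) ∈ {0,1})] -/
theorem polygonChain_apply {v : Vertex L} {w : List (Fin 2 × Bool)}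
    (hinj : Set.InjOn (edgeAt v w) (Set.Iio w.length)) (ℓ : Edge L) :
    polygonChain v w ℓ = if ℓ ∈ polygonEdges v w then 1 else 0 := by
  classical
  unfold polygonChain
  rw [Finset.sum_apply]
  simp only [Pi.single_apply]
  rw [Finset.sum_boole]
  split_ifs with h
  · obtain ⟨k₀, hk₀, rfl⟩ := Finset.mem_image.1 h
    have : (range w.length).filter (fun k => edgeAt v w k₀ = edgeAt v w k) = {k₀} := by
      ext k
      simp only [Finset.mem_filter, Finset.mem_range, Finset.mem_singleton]
      constructor
      · rintro ⟨hk, he⟩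
        exact (hinj (by simpa using hk) (by simpa using Finset.mem_range.1 hk₀) he.symm)
      · rintro rfl
        exact ⟨Finset.mem_range.1 hk₀, rfl⟩
    rw [this, Finset.card_singleton, Nat.cast_one]
  · have : (range w.length).filter (fun k => ℓ = edgeAt v w k) = ∅ := by
      rw [Finset.filter_eq_empty_iff]
      rintro k hk rfl
      exact h (Finset.mem_image.2 ⟨k, hk, rfl⟩)
    rw [this, Finset.card_empty, Nat.cast_zero]

/-- The support of the chain of a polygon is its link set. [cite: DennisEtAl2002, §4.4 (n_E(ℓ) ∈ {0,1})] -/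
theorem supp_polygonChain [NeZero L] {v : Vertex L} {w : List (Fin 2 × Bool)}
    (hinj : Set.InjOn (edgeAt v w) (Set.Iio w.length)) : supp (polygonChain v w) = polygonEdges v w := by
  classical
  ext ℓ
  simp only [supp, Finset.mem_filter, Finset.mem_univ, true_and, polygonChain_apply hinj]
  split_ifs with h <;> simp [h]

/-- The weight of the chain of a polygon is its number of links. [cite: DennisEtAl2002, §5.2 (polygon of length H)] -/
theorem hammingNorm_polygonChain [NeZero L] {v : Vertex L} {w : List (Fin 2 × Bool)}
    (hP : IsPolygon v w) :
    hammingNorm (polygonChain v w) = w.length := by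
  classical
  have h1 : hammingNorm (polygonChain v w) = (supp (polygonChain v w)).card := rfl
  rw [h1, supp_polygonChain hP.edgeAt_injOn, hP.card_polygonEdges]

/-! ### Counting polygons by self-avoiding walks -/

/-- **The first `H - 1` steps of a self-avoiding polygon form a self-avoiding walk of `ℤ²`**
(a lattice path on the torus whose sites are distinct lifts to a self-avoiding walk).
[cite: DennisEtAl2002, §5.3 (polygons counted by self-avoiding walks, eq. (29))] -/
theorem IsPolygon.isSAW_take {v : Vertex L} {w : List (Fin 2 × Bool)} (hP : IsPolygon v w) :
    Word.IsSAW (d := 2) (w.take (w.length - 1)) := by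
  rw [Literature.Probability.RandomPlanarGeometry.SAW.Zd.Word.isSAW_iff_injOn]
  intro i hi j hj hij
  simp only [Set.mem_setOf_eq, List.length_take] at hi hj
  have hi' : i ≤ w.length - 1 := le_trans hi (min_le_left _ _)
  have hj' : j ≤ w.length - 1 := le_trans hj (min_le_left _ _)
  rw [Word.traj_take w hi', Word.traj_take w hj'] at hij
  have h3 := hP.three_le
  have ht : tpos v w i = tpos v w j := by simp only [tpos, hij]
  exact hP.nodup i j (by omega) (by omega) ht

/-- Reconstruction of a polygon from its start site and all but its last step: the links of the
truncated path together with every link joining its last site to the start. [folklore] -/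
private def rebuild [NeZero L] (vw : Vertex L × List (Fin 2 × Bool)) : Finset (Edge L) :=
  polygonEdges vw.1 vw.2 ∪ univ.filter fun ℓ => toSym2 ℓ = s(tpos vw.1 vw.2 vw.2.length, vw.1)

/-- A self-avoiding polygon is recovered from its start site and its first `H - 1` steps
(for `L ≥ 3`: the last link is the unique link joining the last site to the start).
[cite: DennisEtAl2002, §5.3 (polygons counted by self-avoiding walks)] -/
private theorem rebuild_eq [NeZero L] (hL : 3 ≤ L) {v : Vertex L} {w : List (Fin 2 × Bool)}
    (hP : IsPolygon v w) : rebuild (v, w.take (w.length - 1)) = polygonEdges v w := by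
  classical
  have h3 := hP.three_le
  set n := w.length - 1 with hn
  have hlen : (w.take n).length = n := by rw [List.length_take]; omega
  have hw : w.length = n + 1 := by omega
  ext ℓ
  simp only [rebuild, polygonEdges, Finset.mem_union, Finset.mem_image, Finset.mem_range,
    Finset.mem_filter, Finset.mem_univ, true_and, hlen]
  constructor
  · rintro (⟨k, hk, rfl⟩ | h)
    · exact ⟨k, by omega, (edgeAt_take v w hk).symm⟩
    · refine ⟨n, by omega, toSym2_injective hL ?_⟩
      rw [toSym2_edgeAt v w (by omega), h, tpos_take v w le_rfl, ← hw, hP.closed]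
  · rintro ⟨k, hk, rfl⟩
    rcases lt_or_eq_of_le (Nat.le_of_lt_succ (hw ▸ hk)) with hk' | rfl
    · exact Or.inl ⟨k, hk', edgeAt_take v w hk'⟩
    · right
      rw [toSym2_edgeAt v w (by omega), tpos_take v w le_rfl, ← hw, hP.closed]

/-- **`n_SAP(H) ≤ L² · c_{H-1}`**: the link sets of the self-avoiding polygons with `H` links on
the `L × L` toric lattice (`L ≥ 3`) number at most `L²` (start sites) times the number `c_{H-1}`
of `(H-1)`-step self-avoiding walks of `ℤ²` (`Word.sawWords 2 (H-1)`, whose cardinal is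
`SAW.count (H-1)` by `Word.card_sawWords`). DKLP bound polygons by walks in the same way
("`n_SAP(ℓ) ≤ …`", eq. (29)). [cite: DennisEtAl2002, §5.3 eq. (29)] -/
theorem card_polygons_le [NeZero L] (hL : 3 ≤ L) (H : ℕ) (𝒮 : Finset (Finset (Edge L)))
    (h𝒮 : ∀ P ∈ 𝒮, ∃ (v : Vertex L) (w : List (Fin 2 × Bool)), IsPolygon v w ∧ w.length = H ∧
      polygonEdges v w = P) :
    𝒮.card ≤ L ^ 2 * (Word.sawWords 2 (H - 1)).card := by
  classical
  have hsub : 𝒮 ⊆ ((univ : Finset (Vertex L)) ×ˢ Word.sawWords 2 (H - 1)).image rebuild := by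
    intro P hP
    obtain ⟨v, w, hPw, hH, rfl⟩ := h𝒮 P hP
    refine Finset.mem_image.2 ⟨(v, w.take (w.length - 1)), ?_, rebuild_eq hL hPw⟩
    rw [Finset.mem_product]
    refine ⟨Finset.mem_univ _, ?_⟩
    rw [Literature.Probability.RandomPlanarGeometry.SAW.Zd.Word.mem_sawWords]
    have h3 := hPw.three_le
    exact ⟨by simp; omega, hPw.isSAW_take⟩
  calc 𝒮.card ≤ (((univ : Finset (Vertex L)) ×ˢ Word.sawWords 2 (H - 1)).image rebuild).card :=
        Finset.card_le_card hsub
    _ ≤ ((univ : Finset (Vertex L)) ×ˢ Word.sawWords 2 (H - 1)).card := Finset.card_image_le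
    _ = L ^ 2 * (Word.sawWords 2 (H - 1)).card := by
        rw [Finset.card_product, Finset.card_univ]
        congr 1
        simp [Vertex, TorusSite, ZMod.card, Fintype.card_fin]

end ToricCode

end Literature.InformationTheory.QuantumCodes
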